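import Mathlib
import HarnessLib
import Summits.FinalStateConjecture.Statement
import Literature.Geometry.Lorentzian.LandauLifshitzPseudotensor

/-!
# Negative lemma for the crux `InertialRecession` (stmt-FinalStateConjecture-10166): the Kerr–Schild
# STABILISER LOOPHOLE in the typed key lemma `KerrSchildPaintingRigidity` (crux-triage r1-2, finding F1)

`Kerr.bilin M a` is axisymmetric: for the rotation `R_θ` about the `x³` (spin) axis `r`, `H` are invariant
and `ℓ_{R_θ x}(R_θ v) = ℓ_x(v)`, so `g_{M,a}(R_θ x)(R_θ v, R_θ w) = g_{M,a}(x)(v, w)` (all `a`). Hence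
RIGHT-multiplying a motion `Λ : lorentzGroup` by `R_θ` changes nothing the crux's antecedent sees
(`boostedKerrBilin`, `Kerr.radius ∘ poincareInv`, `(Λ e₀)⁰`, smoothness), and the twist `θ(t) = t` maps
witnesses of the antecedent to witnesses, while `‖d/dt (Λᵢ(t)·R_t)‖ ≥ 1 − ‖Λ̇ᵢ(t)‖` (a Lorentz map sends
the unit spacelike vector `R_t′e₁` to a vector of Euclidean norm `≥ 1`). So the key lemma of card
`scale-t-static-sphere-charges` AS TYPED (its statement is INLINED verbatim as the negated
conclusion of the theorem below, since crux workfiles cannot be imported under `Theorems/`; conclusion `t^{3/4}/log t · ‖deriv Λᵢ‖ → 0` for a scale-`t`-isolated hole) refutes itself on any witness: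
`kerrSchildPaintingRigidity_false_of_witness`. This concerns the TYPING, not the mechanism (the card's
`c′MRΛ̇` term only sees `u̇ᵢ = d/dt(Λᵢe₀)`); repaired conclusion:
`Tendsto (fun t ↦ t ^ (3/4) / Real.log t * ‖deriv (fun s ↦ (Λ i s) (E4.basisVector 0)) t‖) atTop (𝓝 0)`
(plus the spin axis `Λᵢe₃` if wanted). The same twist kills the typed `SquareIntegrableModulation` of card
`square-integrable-kicks` (`‖Λ' − Λᵢ‖ → 0` forces `Λ'` to co-rotate), which should ask closeness modulo
the stabiliser. No `sorry`; axioms `propext`, `Classical.choice`, `Quot.sound`.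
-/

set_option linter.dupNamespace false

noncomputable section

namespace Summit.FinalStateConjecture.FinalStateConjecture.Theorems.InertialRecession.Negative

open scoped BigOperators Topology Manifold Classical MeasureTheory Matrix ContDiff
open Filter Set Function TopologicalSpace MeasureTheory Literature.Geometry.Lorentzian

/-! ### Rotations about the Kerr–Schild spin axis -/

/-- Identity on the `(x⁰, x³)` coordinates, zero on `(x¹, x²)`. [folklore] -/
def P03 : E4 →L[ℝ] E4 :=
  (EuclideanSpace.proj (0 : Fin 4) : E4 →L[ℝ] ℝ).smulRight (E4.basisVector 0) +
    (EuclideanSpace.proj (3 : Fin 4) : E4 →L[ℝ] ℝ).smulRight (E4.basisVector 3)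

/-- Identity on the `(x¹, x²)` coordinates, zero on `(x⁰, x³)`. [folklore] -/
def P12 : E4 →L[ℝ] E4 :=
  (EuclideanSpace.proj (1 : Fin 4) : E4 →L[ℝ] ℝ).smulRight (E4.basisVector 1) +
    (EuclideanSpace.proj (2 : Fin 4) : E4 →L[ℝ] ℝ).smulRight (E4.basisVector 2)

/-- The generator of rotations in the `(x¹, x²)` plane: `e₁ ↦ e₂`, `e₂ ↦ −e₁`. [folklore] -/
def J12 : E4 →L[ℝ] E4 :=
  (EuclideanSpace.proj (1 : Fin 4) : E4 →L[ℝ] ℝ).smulRight (E4.basisVector 2) -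
    (EuclideanSpace.proj (2 : Fin 4) : E4 →L[ℝ] ℝ).smulRight (E4.basisVector 1)

/-- Rotation by the angle `θ` about the `x³` axis, as a continuous linear map of `E4`. [folklore] -/
def rotCLM (θ : ℝ) : E4 →L[ℝ] E4 := P03 + Real.cos θ • P12 + Real.sin θ • J12

/-- The `θ`-derivative of `rotCLM`. [folklore] -/
def rotCLM' (θ : ℝ) : E4 →L[ℝ] E4 := -Real.sin θ • P12 + Real.cos θ • J12

/-- The rotation fixes the time coordinate. [folklore] -/
@[simp] lemma rotCLM_apply_zero (θ : ℝ) (v : E4) : rotCLM θ v 0 = v 0 := by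
  simp [rotCLM, P03, P12, J12]

/-- First spatial component of the rotated vector. [folklore] -/
@[simp] lemma rotCLM_apply_one (θ : ℝ) (v : E4) :
    rotCLM θ v 1 = Real.cos θ * v 1 - Real.sin θ * v 2 := by
  simp [rotCLM, P03, P12, J12]; ring

/-- Second spatial component of the rotated vector. [folklore] -/
@[simp] lemma rotCLM_apply_two (θ : ℝ) (v : E4) :
    rotCLM θ v 2 = Real.sin θ * v 1 + Real.cos θ * v 2 := by
  simp [rotCLM, P03, P12, J12]; ring

/-- The rotation fixes the spin-axis coordinate. [folklore] -/
@[simp] lemma rotCLM_apply_three (θ : ℝ) (v : E4) : rotCLM θ v 3 = v 3 := by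
  simp [rotCLM, P03, P12, J12]

/-- The generator kills the time coordinate. [folklore] -/
@[simp] lemma rotCLM'_apply_zero (θ : ℝ) (v : E4) : rotCLM' θ v 0 = 0 := by
  simp [rotCLM', P12, J12]

/-- First spatial component of the derivative of the rotation. [folklore] -/
@[simp] lemma rotCLM'_apply_one (θ : ℝ) (v : E4) :
    rotCLM' θ v 1 = -Real.sin θ * v 1 - Real.cos θ * v 2 := by
  simp [rotCLM', P12, J12]; ring

/-- Second spatial component of the derivative of the rotation. [folklore] -/
@[simp] lemma rotCLM'_apply_two (θ : ℝ) (v : E4) :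
    rotCLM' θ v 2 = Real.cos θ * v 1 - Real.sin θ * v 2 := by
  simp [rotCLM', P12, J12]; ring

/-- The generator kills the spin-axis coordinate. [folklore] -/
@[simp] lemma rotCLM'_apply_three (θ : ℝ) (v : E4) : rotCLM' θ v 3 = 0 := by
  simp [rotCLM', P12, J12]

/-- Componentwise extensionality on `E4` (cf. `euclidean_four_ext`; private, minimal imports). [folklore] -/
private theorem ext4 {v w : E4} (h0 : v 0 = w 0) (h1 : v 1 = w 1) (h2 : v 2 = w 2) (h3 : v 3 = w 3) :
    v = w := by
  ext k
  fin_cases k <;> assumption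

/-- Rotations about the spin axis compose by adding angles. [folklore] -/
lemma rotCLM_rotCLM (θ φ : ℝ) (v : E4) : rotCLM θ (rotCLM φ v) = rotCLM (θ + φ) v := by
  refine ext4 ?_ ?_ ?_ ?_
  · simp
  · simp [Real.cos_add, Real.sin_add]; ring
  · simp [Real.cos_add, Real.sin_add]; ring
  · simp

/-- The rotation by angle `0` is the identity. [folklore] -/
lemma rotCLM_zero (v : E4) : rotCLM 0 v = v := by refine ext4 ?_ ?_ ?_ ?_ <;> simp

/-- Rotation about the spin axis as a continuous linear automorphism of `E4`. [folklore] -/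
def rotEquiv (θ : ℝ) : E4 ≃L[ℝ] E4 :=
  ContinuousLinearEquiv.equivOfInverse (rotCLM θ) (rotCLM (-θ))
    (fun v ↦ by rw [rotCLM_rotCLM, neg_add_cancel, rotCLM_zero])
    (fun v ↦ by rw [rotCLM_rotCLM, add_neg_cancel, rotCLM_zero])

/-- Unfolding lemma for `rotEquiv`. [folklore] -/
@[simp] lemma rotEquiv_apply (θ : ℝ) (v : E4) : rotEquiv θ v = rotCLM θ v := rfl

/-- The inverse rotation is the rotation by the opposite angle. [folklore] -/
@[simp] lemma rotEquiv_symm_apply (θ : ℝ) (v : E4) : (rotEquiv θ).symm v = rotCLM (-θ) v := rfl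

/-- Rotations about the spin axis preserve the Minkowski form. [folklore] -/
lemma minkowski_rotCLM (θ : ℝ) (v w : E4) :
    Minkowski.bilin (rotCLM θ v) (rotCLM θ w) = Minkowski.bilin v w := by
  simp only [Minkowski.bilin_apply, Fin.sum_univ_three]
  simp only [show (1 : Fin 3).succ = 2 from rfl, show (2 : Fin 3).succ = 3 from rfl,
    show (0 : Fin 3).succ = 1 from rfl, rotCLM_apply_zero, rotCLM_apply_one, rotCLM_apply_two,
    rotCLM_apply_three]
  linear_combination (v 1 * w 1 + v 2 * w 2) * Real.sin_sq_add_cos_sq θ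

/-- Rotations about the spin axis are Lorentz transformations. [folklore] -/
lemma rotEquiv_mem_lorentzGroup (θ : ℝ) : rotEquiv θ ∈ lorentzGroup := minkowski_rotCLM θ

/-- Rotation about the spin axis as an element of the Lorentz group `lorentzGroup`. [folklore] -/
def rotL (θ : ℝ) : lorentzGroup := ⟨rotEquiv θ, rotEquiv_mem_lorentzGroup θ⟩

/-- Rotations about the spin axis are Euclidean isometries of `E4`. [folklore] -/
lemma norm_rotCLM (θ : ℝ) (v : E4) : ‖rotCLM θ v‖ = ‖v‖ := by
  have h : ‖rotCLM θ v‖ ^ 2 = ‖v‖ ^ 2 := by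
    rw [EuclideanSpace.real_norm_sq_eq, EuclideanSpace.real_norm_sq_eq, Fin.sum_univ_four,
      Fin.sum_univ_four]
    simp only [rotCLM_apply_zero, rotCLM_apply_one, rotCLM_apply_two, rotCLM_apply_three]
    linear_combination (v 1 ^ 2 + v 2 ^ 2) * Real.sin_sq_add_cos_sq θ
  exact (pow_left_inj₀ (norm_nonneg _) (norm_nonneg _) two_ne_zero).mp h

/-- The operator norm of a rotation is at most `1`. [folklore] -/
lemma opNorm_rotCLM_le (θ : ℝ) : ‖rotCLM θ‖ ≤ 1 :=
  ContinuousLinearMap.opNorm_le_bound _ zero_le_one fun v ↦ by rw [one_mul, norm_rotCLM]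

/-! ### Axisymmetry of the Kerr–Schild form -/

/-- Rotations about the spin axis preserve the spatial radius. [folklore] -/
lemma spatialNorm_sq_rotCLM (θ : ℝ) (x : E4) :
    E4.spatialNorm (rotCLM θ x) ^ 2 = E4.spatialNorm x ^ 2 := by
  rw [E4.spatialNorm_sq, E4.spatialNorm_sq]
  simp only [rotCLM_apply_one, rotCLM_apply_two, rotCLM_apply_three]
  linear_combination (x 1 ^ 2 + x 2 ^ 2) * Real.sin_sq_add_cos_sq θ

/-- The Kerr–Schild radius is axisymmetric. [folklore] -/
theorem radius_rotCLM (θ a : ℝ) (x : E4) : Kerr.radius a (rotCLM θ x) = Kerr.radius a x := by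
  unfold Kerr.radius; rw [spatialNorm_sq_rotCLM, rotCLM_apply_three]

/-- The Kerr–Schild scalar `H` is axisymmetric. [folklore] -/
theorem scalarH_rotCLM (θ M a : ℝ) (x : E4) : Kerr.scalarH M a (rotCLM θ x) = Kerr.scalarH M a x := by
  unfold Kerr.scalarH; rw [radius_rotCLM, rotCLM_apply_three]

/-- The Kerr–Schild null covector rotates covariantly about the spin axis. [folklore] -/
theorem nullCovector_rotCLM (θ a : ℝ) (x v : E4) :
    Kerr.nullCovector a (rotCLM θ x) (rotCLM θ v) = Kerr.nullCovector a x v := by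
  simp only [Kerr.nullCovector, Kerr.nullCovectorFun, E4.covector_apply, Fin.sum_univ_four,
    radius_rotCLM, rotCLM_apply_zero, rotCLM_apply_one, rotCLM_apply_two, rotCLM_apply_three,
    Matrix.cons_val_zero, Matrix.cons_val_one, Matrix.cons_val]
  simp only [div_eq_mul_inv]
  linear_combination ((Kerr.radius a x * (x 1 * v 1 + x 2 * v 2) + a * (x 2 * v 1 - x 1 * v 2)) *
    (Kerr.radius a x ^ 2 + a ^ 2)⁻¹) * Real.sin_sq_add_cos_sq θ

/-- **Axisymmetry of the Kerr metric in Kerr–Schild form.** [folklore] -/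
theorem kerrBilin_rotCLM (θ M a : ℝ) (x v w : E4) :
    Kerr.bilin M a (rotCLM θ x) (rotCLM θ v) (rotCLM θ w) = Kerr.bilin M a x v w := by
  rw [Kerr.bilin_apply, Kerr.bilin_apply, scalarH_rotCLM, nullCovector_rotCLM, nullCovector_rotCLM,
    minkowski_rotCLM]

/-! ### Twisting a motion by a spin-axis rotation is invisible to the crux's antecedent -/

/-- Unfolding the group law: `(Λ·R_θ) v = Λ (R_θ v)`. [folklore] -/
lemma mul_rotL_apply (Λ : lorentzGroup) (θ : ℝ) (v : E4) :
    ((Λ * rotL θ : lorentzGroup) : E4 ≃L[ℝ] E4) v = (Λ : E4 ≃L[ℝ] E4) (rotCLM θ v) := rfl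

/-- Unfolding the inverse of the twisted motion: `(Λ·R_θ)⁻¹ v = R_{-θ} (Λ⁻¹ v)`. [folklore] -/
lemma mul_rotL_symm_apply (Λ : lorentzGroup) (θ : ℝ) (v : E4) :
    ((Λ * rotL θ : lorentzGroup) : E4 ≃L[ℝ] E4).symm v = rotCLM (-θ) ((Λ : E4 ≃L[ℝ] E4).symm v) :=
  rfl

/-- The twisted motion as a continuous linear map is the composition `Λ ∘ R_θ`. [folklore] -/
lemma coe_mul_rotL (Λ : lorentzGroup) (θ : ℝ) :
    (((Λ * rotL θ : lorentzGroup) : E4 ≃L[ℝ] E4) : E4 →L[ℝ] E4) =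
      ((Λ : E4 ≃L[ℝ] E4) : E4 →L[ℝ] E4).comp (rotCLM θ) := rfl

/-- Rest-frame coordinates of the twisted motion are the rotated rest-frame coordinates. [folklore] -/
lemma poincareInv_mul_rotL (Λ : lorentzGroup) (θ : ℝ) (c x : E4) :
    poincareInv (Λ * rotL θ) c x = rotCLM (-θ) (poincareInv Λ c x) := rfl

/-- The painted Kerr–Schild RADIUS does not see the twist. [folklore] -/
theorem radius_poincareInv_mul_rotL (Λ : lorentzGroup) (θ a : ℝ) (c x : E4) :
    Kerr.radius a (poincareInv (Λ * rotL θ) c x) = Kerr.radius a (poincareInv Λ c x) := by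
  rw [poincareInv_mul_rotL, radius_rotCLM]

/-- The BOOSTED KERR–SCHILD FORM does not see the twist. [folklore] -/
theorem boostedKerrBilin_mul_rotL (Λ : lorentzGroup) (θ : ℝ) (c : E4) (M a : ℝ) (x : E4) :
    boostedKerrBilin (Λ * rotL θ) c M a x = boostedKerrBilin Λ c M a x := by
  ext v w
  rw [boostedKerrBilin_apply, boostedKerrBilin_apply, poincareInv_mul_rotL, mul_rotL_symm_apply,
    mul_rotL_symm_apply, kerrBilin_rotCLM]

/-- The rotation fixes `∂ₜ`. [folklore] -/
lemma rotCLM_basisVector_zero (θ : ℝ) : rotCLM θ (E4.basisVector 0) = E4.basisVector 0 :=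
  ext4 (by simp) (by simp) (by simp) (by simp)

/-- The LORENTZ-FACTOR clause does not see the twist. [folklore] -/
theorem mul_rotL_basisVector_zero_apply (Λ : lorentzGroup) (θ : ℝ) :
    ((Λ * rotL θ : lorentzGroup) : E4 ≃L[ℝ] E4) (E4.basisVector 0) 0 =
      (Λ : E4 ≃L[ℝ] E4) (E4.basisVector 0) 0 := by
  rw [mul_rotL_apply, rotCLM_basisVector_zero]

/-! ### Smoothness, derivative and the lower bound -/

/-- The rotation is differentiable in the angle with derivative `rotCLM'`. [folklore] -/
lemma hasDerivAt_rotCLM (θ : ℝ) : HasDerivAt rotCLM (rotCLM' θ) θ := by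
  have h1 : HasDerivAt (fun θ ↦ Real.cos θ • P12) (-Real.sin θ • P12) θ :=
    (Real.hasDerivAt_cos θ).smul_const P12
  have h2 : HasDerivAt (fun θ ↦ Real.sin θ • J12) (Real.cos θ • J12) θ :=
    (Real.hasDerivAt_sin θ).smul_const J12
  exact (h1.const_add P03).fun_add h2

/-- The rotation is smooth in the angle. [folklore] -/
lemma contDiff_rotCLM : ContDiff ℝ ((⊤ : ℕ∞) : WithTop ℕ∞) rotCLM := by
  have hf : rotCLM = fun θ ↦ P03 + Real.cos θ • P12 + Real.sin θ • J12 := rfl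
  rw [hf]
  exact (contDiff_const.add (Real.contDiff_cos.smul contDiff_const)).add
    (Real.contDiff_sin.smul contDiff_const)

/-- A Lorentz transformation sends a UNIT SPACELIKE vector to a vector of Euclidean norm `≥ 1`
(`η(w,w) = 1` forces `|w̲|² = 1 + (w⁰)²`). [folklore] -/
theorem one_le_norm_lorentz_apply (Λ : lorentzGroup) (u : E4) (hu : Minkowski.bilin u u = 1) :
    1 ≤ ‖(Λ : E4 ≃L[ℝ] E4) u‖ := by
  set w := (Λ : E4 ≃L[ℝ] E4) u with hw
  have hη : Minkowski.bilin w w = 1 := by rw [hw, Λ.2 u u, hu]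
  have hsq : 1 ≤ ‖w‖ ^ 2 := by
    rw [EuclideanSpace.real_norm_sq_eq, Fin.sum_univ_four]
    simp only [Minkowski.bilin_apply, Fin.sum_univ_three, show (1 : Fin 3).succ = 2 from rfl,
      show (2 : Fin 3).succ = 3 from rfl, show (0 : Fin 3).succ = 1 from rfl] at hη
    nlinarith [sq_nonneg (w 0), sq_abs (w 0), sq_abs (w 1), sq_abs (w 2), sq_abs (w 3)]
  nlinarith [norm_nonneg w]

/-- The twisted motion turns at Euclidean operator speed at least `1 − ‖Λ̇‖`. [folklore] -/
theorem one_sub_le_norm_deriv_twist (Λ : ℝ → lorentzGroup)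
    (hΛ : ContDiff ℝ ((⊤ : ℕ∞) : WithTop ℕ∞) (fun t ↦ ((Λ t : E4 ≃L[ℝ] E4) : E4 →L[ℝ] E4))) (t : ℝ) :
    1 - ‖deriv (fun s ↦ ((Λ s : E4 ≃L[ℝ] E4) : E4 →L[ℝ] E4)) t‖ ≤
      ‖deriv (fun s ↦ ((Λ s : E4 ≃L[ℝ] E4) : E4 →L[ℝ] E4).comp (rotCLM s)) t‖ := by
  set F : ℝ → E4 →L[ℝ] E4 := fun s ↦ ((Λ s : E4 ≃L[ℝ] E4) : E4 →L[ℝ] E4) with hF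
  have hdiff : Differentiable ℝ F := hΛ.differentiable (by simp)
  have hder : HasDerivAt (fun s ↦ (F s).comp (rotCLM s))
      ((deriv F t).comp (rotCLM t) + (F t).comp (rotCLM' t)) t :=
    (hdiff t).hasDerivAt.clm_comp (hasDerivAt_rotCLM t)
  rw [hder.deriv]
  -- the main term has norm ≥ 1
  set u : E4 := rotCLM' t (E4.basisVector 1) with hu
  have hu1 : Minkowski.bilin u u = 1 := by
    simp only [hu, Minkowski.bilin_apply, Fin.sum_univ_three, show (1 : Fin 3).succ = 2 from rfl,
      show (2 : Fin 3).succ = 3 from rfl, show (0 : Fin 3).succ = 1 from rfl, rotCLM'_apply_zero,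
      rotCLM'_apply_one, rotCLM'_apply_two, rotCLM'_apply_three]
    simp
    linear_combination Real.sin_sq_add_cos_sq t
  have hmain : 1 ≤ ‖(F t).comp (rotCLM' t)‖ := by
    have h1 : 1 ≤ ‖((F t).comp (rotCLM' t)) (E4.basisVector 1)‖ := by
      simpa [hF] using one_le_norm_lorentz_apply (Λ t) u hu1
    have h2 := ((F t).comp (rotCLM' t)).le_opNorm (E4.basisVector 1)
    have h3 : ‖(E4.basisVector 1 : E4)‖ = 1 := by simp
    rw [h3, mul_one] at h2
    exact h1.trans h2
  have hsmall : ‖(deriv F t).comp (rotCLM t)‖ ≤ ‖deriv F t‖ :=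
    (ContinuousLinearMap.opNorm_comp_le _ _).trans
      (mul_le_of_le_one_right (norm_nonneg _) (opNorm_rotCLM_le t))
  have htri := norm_sub_le ((deriv F t).comp (rotCLM t) + (F t).comp (rotCLM' t))
    ((deriv F t).comp (rotCLM t))
  rw [add_sub_cancel_left] at htri
  linarith

/-- Eventually `t^{3/4} / log t ≥ 3/4` (from `log t ≤ t^{3/4}/(3/4)`). [folklore] -/
theorem eventually_weight_ge : ∀ᶠ t : ℝ in atTop, (3 / 4 : ℝ) ≤ t ^ (3 / 4 : ℝ) / Real.log t := by
  filter_upwards [eventually_gt_atTop 1] with t ht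
  have hlog : 0 < Real.log t := Real.log_pos ht
  have hle : Real.log t ≤ t ^ (3 / 4 : ℝ) / (3 / 4) := Real.log_le_rpow_div (by linarith) (by norm_num)
  rw [le_div_iff₀ hlog]
  have := (le_div_iff₀ (by norm_num : (0:ℝ) < 3 / 4)).mp hle
  linarith

/-! ### The negative lemma -/

/-- **`KerrSchildPaintingRigidity` is false AS TYPED on every witness of its own hypothesis**
(crux-triage r1-2, finding F1): if the crux's antecedent block holds for some admissible datum, MGHD,
lab chart and painted moduli with a hole `i` isolated at scale `t`, then twisting `Λᵢ` by the unit-rate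
rotation about its spin axis gives a second witness with the SAME antecedent (axisymmetry of the
Kerr–Schild form), on which the lemma's conclusion `t^{3/4}/log t · ‖Λ̇ᵢ‖ → 0` fails, since
`‖d/dt(Λᵢ·R_t)‖ ≥ 1 − ‖Λ̇ᵢ‖` and, by the lemma applied to the untwisted witness, `‖Λ̇ᵢ‖ → 0`. Repair:
conclude about `d/dt (Λᵢ e₀)` (and `Λᵢ e₃`) instead of `deriv Λᵢ`. [folklore] -/
theorem kerrSchildPaintingRigidity_false_of_witness
    {X : Type} [TopologicalSpace X] [ChartedSpace E3 X] [IsManifold (𝓡 3) ((⊤ : ℕ∞) : WithTop ℕ∞) X]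
    [T2Space X] [SecondCountableTopology X] [ConnectedSpace X]
    {D : InitialDataSet (𝓡 3) X} (hD : D ∈ admissibleVacuumData X) (𝒟 : VacuumCauchyDevelopment D)
    (h𝒟 : 𝒟.IsMaximal) {N : ℕ} {M a rin : Fin N → ℝ} {Λ : Fin N → ℝ → lorentzGroup}
    {ξ : Fin N → ℝ → E3} {γ κ τ₀ : ℝ} {U : TopologicalSpace.Opens E4} {Φ : U → 𝒟.carrier}
    {O : Set 𝒟.carrier}
    (hblock : ((∀ i, Kerr.IsSubextremal (M i) (a i) ∧ Kerr.rMinus (M i) (a i) < rin i ∧ rin i < Kerr.rPlus (M i) (a i)) ∧ (∀ i t, |((Λ i t : E4 ≃L[ℝ] E4) (E4.basisVector 0)) 0| ≤ γ) ∧ (∀ i, ContDiff ℝ ((⊤ : ℕ∞) : WithTop ℕ∞) (ξ i) ∧ ContDiff ℝ ((⊤ : ℕ∞) : WithTop ℕ∞) (fun t ↦ ((Λ i t : E4 ≃L[ℝ] E4) : E4 →L[ℝ] E4))) ∧ (∀ i j, i ≠ j → Tendsto (fun t ↦ ‖ξ i t - ξ j t‖) atTop atTop) ∧ (0 < κ ∧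 κ < 1 ∧ ∀ i, ∀ᶠ t in atTop, ‖ξ i t‖ ≤ κ ^ 2 * t) ∧ ({x : E4 | τ₀ < x 0 ∧ ∀ i, rin i < Kerr.radius (a i) (poincareInv (Λ i (x 0)) (E4.ofTimeSpace (x 0) (ξ i (x 0))) x)} ⊆ (U : Set E4)) ∧ let B : ModelBackground := ⟨U, fun x ↦ Minkowski.bilin + ∑ i, (boostedKerrBilin (Λ i (x 0)) (E4.ofTimeSpace (x 0) (ξ i (x 0))) (M i) (a i) x - Minkowski.bilin), fun x ↦ x 0, E4.spatialNorm⟩; ContMDiff 𝓘(ℝ, E4) (𝓡 4) ((⊤ : ℕ∞) : WithTop ℕ∞) Φ ∧ Topology.IsOpenEmbedding ((B.lateRegion τ₀).restrict Φ) ∧ Φ '' {x : U | τ₀ < x.1 0 ∧ ∀ i, Kerr.rPlus (M i) (a i) < Kerr.radius (a i) (poincareInv (Λ i (x.1 0)) (E4.ofTimeSpace (x.1 0) (ξ i (x.1 0))) x.1)} ⊆ O ∧ Tendsto (fun t ↦ 𝒟.toSpacetime.deviationCk B Φ 3 t) atTop (𝓝 0) ∧ Tendsto (fun t : ℝ ↦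 ⨆ x ∈ {x : U | x.1 0 = t ∧ E4.spatialNorm x.1 ≤ κ * t}, ⨆ (m : ℕ) (_ : m ≤ 3), ENNReal.ofReal (1 + √(√((⨅ i, ‖E4.spatial x.1 - ξ i t‖) ^ 7))) * ‖iteratedFDeriv ℝ m (𝒟.toSpacetime.deviationExtend B Φ) x.1‖ₑ) atTop (𝓝 0) ∧ O = Summit.FinalStateConjecture.exteriorOf 𝒟.toCauchyDevelopment (Φ '' {x : U | τ₀ < x.1 0 ∧ ∀ i, Kerr.rPlus (M i) (a i) < Kerr.radius (a i) (poincareInv (Λ i (x.1 0)) (E4.ofTimeSpace (x.1 0) (ξ i (x.1 0))) x.1)}) ∧ ∀ t₁ : ℝ, τ₀ < t₁ → O \ Φ '' {x : U | t₁ < x.1 0 ∧ ∀ i, Kerr.rPlus (M i) (a i) < Kerr.radius (a i) (poincareInv (Λ i (x.1 0)) (E4.ofTimeSpace (x.1 0) (ξ i (x.1 0))) x.1)} ⊆ 𝒟.metric.causalPast 𝒟.timeOrientation (Φ '' {x : U | x.1 0 = t₁ ∧ ∀ i, Kerr.rPlus (M i) (a i) < Kerr.radius (a i) (poincareInv (Λ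 i (x.1 0)) (E4.ofTimeSpace (x.1 0) (ξ i (x.1 0))) x.1)})))
    {i₀ : Fin N} (hiso : ∀ j : Fin N, j ≠ i₀ → ∃ c : ℝ, 0 < c ∧ ∀ᶠ t in atTop, c * t ≤ ‖ξ i₀ t - ξ j t‖) :
    ¬ (∀ (X : Type) [TopologicalSpace X] [ChartedSpace E3 X] [IsManifold (𝓡 3) ((⊤ : ℕ∞) : WithTop ℕ∞) X] [T2Space X] [SecondCountableTopology X] [ConnectedSpace X], ∀ D ∈ admissibleVacuumData X, ∀ 𝒟 : VacuumCauchyDevelopment D, 𝒟.IsMaximal → ∀ (N : ℕ) (M a rin : Fin N → ℝ) (Λ : Fin N → ℝ → lorentzGroup) (ξ : Fin N → ℝ → E3) (γ κ τ₀ : ℝ) (U : Opens E4) (Φ : U → 𝒟.carrier) (O : Set 𝒟.carrier), ((∀ i, Kerr.IsSubextremal (M i) (a i) ∧ Kerr.rMinus (M i) (a i) < rin i ∧ rin i < Kerr.rPlus (M i) (a i)) ∧ (∀ i t, |((Λ i t : E4 ≃L[ℝ] E4) (E4.basisVector 0)) 0| ≤ γ) ∧ (∀ i, ContDiff ℝ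 ((⊤ : ℕ∞) : WithTop ℕ∞) (ξ i) ∧ ContDiff ℝ ((⊤ : ℕ∞) : WithTop ℕ∞) (fun t ↦ ((Λ i t : E4 ≃L[ℝ] E4) : E4 →L[ℝ] E4))) ∧ (∀ i j, i ≠ j → Tendsto (fun t ↦ ‖ξ i t - ξ j t‖) atTop atTop) ∧ (0 < κ ∧ κ < 1 ∧ ∀ i, ∀ᶠ t in atTop, ‖ξ i t‖ ≤ κ ^ 2 * t) ∧ ({x : E4 | τ₀ < x 0 ∧ ∀ i, rin i < Kerr.radius (a i) (poincareInv (Λ i (x 0)) (E4.ofTimeSpace (x 0) (ξ i (x 0))) x)} ⊆ (U : Set E4)) ∧ let B : ModelBackground := ⟨U, fun x ↦ Minkowski.bilin + ∑ i, (boostedKerrBilin (Λ i (x 0)) (E4.ofTimeSpace (x 0) (ξ i (x 0))) (M i) (a i) x - Minkowski.bilin), fun x ↦ x 0, E4.spatialNorm⟩; ContMDiff 𝓘(ℝ, E4) (𝓡 4) ((⊤ : ℕ∞) : WithTop ℕ∞) Φ ∧ Topology.IsOpenEmbedding ((B.lateRegion τ₀).restrict Φ) ∧ Φ '' {x : U |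 τ₀ < x.1 0 ∧ ∀ i, Kerr.rPlus (M i) (a i) < Kerr.radius (a i) (poincareInv (Λ i (x.1 0)) (E4.ofTimeSpace (x.1 0) (ξ i (x.1 0))) x.1)} ⊆ O ∧ Tendsto (fun t ↦ 𝒟.toSpacetime.deviationCk B Φ 3 t) atTop (𝓝 0) ∧ Tendsto (fun t : ℝ ↦ ⨆ x ∈ {x : U | x.1 0 = t ∧ E4.spatialNorm x.1 ≤ κ * t}, ⨆ (m : ℕ) (_ : m ≤ 3), ENNReal.ofReal (1 + √(√((⨅ i, ‖E4.spatial x.1 - ξ i t‖) ^ 7))) * ‖iteratedFDeriv ℝ m (𝒟.toSpacetime.deviationExtend B Φ) x.1‖ₑ) atTop (𝓝 0) ∧ O = Summit.FinalStateConjecture.exteriorOf 𝒟.toCauchyDevelopment (Φ '' {x : U | τ₀ < x.1 0 ∧ ∀ i, Kerr.rPlus (M i) (a i) < Kerr.radius (a i) (poincareInv (Λ i (x.1 0)) (E4.ofTimeSpace (x.1 0) (ξ i (x.1 0))) x.1)}) ∧ ∀ t₁ : ℝ, τ₀ < t₁ → O \ Φ '' {x : U | t₁ < x.1 0 ∧ ∀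 i, Kerr.rPlus (M i) (a i) < Kerr.radius (a i) (poincareInv (Λ i (x.1 0)) (E4.ofTimeSpace (x.1 0) (ξ i (x.1 0))) x.1)} ⊆ 𝒟.metric.causalPast 𝒟.timeOrientation (Φ '' {x : U | x.1 0 = t₁ ∧ ∀ i, Kerr.rPlus (M i) (a i) < Kerr.radius (a i) (poincareInv (Λ i (x.1 0)) (E4.ofTimeSpace (x.1 0) (ξ i (x.1 0))) x.1)})) → ∀ i : Fin N, (∀ j : Fin N, j ≠ i → ∃ c : ℝ, 0 < c ∧ ∀ᶠ t in atTop, c * t ≤ ‖ξ i t - ξ j t‖) → Tendsto (fun t : ℝ ↦ t ^ (3 / 4 : ℝ) / Real.log t * ‖deriv (fun s ↦ ((Λ i s : E4 ≃L[ℝ] E4) : E4 →L[ℝ] E4)) t‖) atTop (𝓝 0)) := by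
  intro hR
  have horig := hR X D hD 𝒟 h𝒟 N M a rin Λ ξ γ κ τ₀ U Φ O hblock i₀ hiso
  have hblock' : ((∀ i, Kerr.IsSubextremal (M i) (a i) ∧ Kerr.rMinus (M i) (a i) < rin i ∧ rin i < Kerr.rPlus (M i) (a i)) ∧ (∀ i t, |(((fun j t ↦ Λ j t * rotL (if j = i₀ then t else 0)) i t : E4 ≃L[ℝ] E4) (E4.basisVector 0)) 0| ≤ γ) ∧ (∀ i, ContDiff ℝ ((⊤ : ℕ∞) : WithTop ℕ∞) (ξ i) ∧ ContDiff ℝ ((⊤ : ℕ∞) : WithTop ℕ∞) (fun t ↦ (((fun j t ↦ Λ j t * rotL (if j = i₀ then t else 0)) i t : E4 ≃L[ℝ] E4) : E4 →L[ℝ] E4))) ∧ (∀ i j, i ≠ j → Tendsto (fun t ↦ ‖ξ i t - ξ j t‖) atTop atTop) ∧ (0 < κ ∧ κ < 1 ∧ ∀ i, ∀ᶠ t in atTop, ‖ξ i t‖ ≤ κ ^ 2 * t) ∧ ({x : E4 | τ₀ < x 0 ∧ ∀ i, rin i < Kerr.radius (a i) (poincareInv ((fun j t ↦ Λ j t * rotL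 (if j = i₀ then t else 0)) i (x 0)) (E4.ofTimeSpace (x 0) (ξ i (x 0))) x)} ⊆ (U : Set E4)) ∧ let B : ModelBackground := ⟨U, fun x ↦ Minkowski.bilin + ∑ i, (boostedKerrBilin ((fun j t ↦ Λ j t * rotL (if j = i₀ then t else 0)) i (x 0)) (E4.ofTimeSpace (x 0) (ξ i (x 0))) (M i) (a i) x - Minkowski.bilin), fun x ↦ x 0, E4.spatialNorm⟩; ContMDiff 𝓘(ℝ, E4) (𝓡 4) ((⊤ : ℕ∞) : WithTop ℕ∞) Φ ∧ Topology.IsOpenEmbedding ((B.lateRegion τ₀).restrict Φ) ∧ Φ '' {x : U | τ₀ < x.1 0 ∧ ∀ i, Kerr.rPlus (M i) (a i) < Kerr.radius (a i) (poincareInv ((fun j t ↦ Λ j t * rotL (if j = i₀ then t else 0)) i (x.1 0)) (E4.ofTimeSpace (x.1 0) (ξ i (x.1 0))) x.1)} ⊆ O ∧ Tendsto (fun t ↦ 𝒟.toSpacetime.deviationCk B Φ 3 t) atTop (𝓝 0) ∧ Tendsto (fun t : ℝ ↦ ⨆ x ∈ {x : U | x.1 0 = t ∧ E4.spatialNorm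 x.1 ≤ κ * t}, ⨆ (m : ℕ) (_ : m ≤ 3), ENNReal.ofReal (1 + √(√((⨅ i, ‖E4.spatial x.1 - ξ i t‖) ^ 7))) * ‖iteratedFDeriv ℝ m (𝒟.toSpacetime.deviationExtend B Φ) x.1‖ₑ) atTop (𝓝 0) ∧ O = Summit.FinalStateConjecture.exteriorOf 𝒟.toCauchyDevelopment (Φ '' {x : U | τ₀ < x.1 0 ∧ ∀ i, Kerr.rPlus (M i) (a i) < Kerr.radius (a i) (poincareInv ((fun j t ↦ Λ j t * rotL (if j = i₀ then t else 0)) i (x.1 0)) (E4.ofTimeSpace (x.1 0) (ξ i (x.1 0))) x.1)}) ∧ ∀ t₁ : ℝ, τ₀ < t₁ → O \ Φ '' {x : U | t₁ < x.1 0 ∧ ∀ i, Kerr.rPlus (M i) (a i) < Kerr.radius (a i) (poincareInv ((fun j t ↦ Λ j t * rotL (if j = i₀ then t else 0)) i (x.1 0)) (E4.ofTimeSpace (x.1 0) (ξ i (x.1 0))) x.1)} ⊆ 𝒟.metric.causalPast 𝒟.timeOrientation (Φ '' {x : U | x.1 0 = t₁ ∧ ∀ i, Kerr.rPlus (M i)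 (a i) < Kerr.radius (a i) (poincareInv ((fun j t ↦ Λ j t * rotL (if j = i₀ then t else 0)) i (x.1 0)) (E4.ofTimeSpace (x.1 0) (ξ i (x.1 0))) x.1)})) := by
    refine ⟨hblock.1, fun j t ↦ ?_, fun j ↦ ⟨(hblock.2.2.1 j).1, ?_⟩, hblock.2.2.2.1, hblock.2.2.2.2.1,
      ?_, ?_⟩
    · -- Lorentz-factor clause
      show |(((Λ j t * rotL (if j = i₀ then t else 0) : lorentzGroup) : E4 ≃L[ℝ] E4)
        (E4.basisVector 0)) 0| ≤ γ
      rw [mul_rotL_basisVector_zero_apply]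
      exact hblock.2.1 j t
    · -- smoothness clause
      show ContDiff ℝ ((⊤ : ℕ∞) : WithTop ℕ∞)
        (fun t ↦ ((Λ j t : E4 ≃L[ℝ] E4) : E4 →L[ℝ] E4).comp (rotCLM (if j = i₀ then t else 0)))
      have hθ : ContDiff ℝ ((⊤ : ℕ∞) : WithTop ℕ∞) (fun t : ℝ ↦ if j = i₀ then t else 0) := by
        by_cases hj : j = i₀
        · simp only [hj, if_true]; exact contDiff_id
        · simp only [hj, if_false]; exact contDiff_const
      exact (hblock.2.2.1 j).2.clm_comp (contDiff_rotCLM.comp hθ)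
    · -- chart-domain clause
      simpa only [radius_poincareInv_mul_rotL] using hblock.2.2.2.2.2.1
    · -- the `let B` group: background form, painted radii
      have hrest := hblock.2.2.2.2.2.2
      have hbil : (fun x : E4 ↦ Minkowski.bilin + ∑ i, (boostedKerrBilin
            ((fun j t ↦ Λ j t * rotL (if j = i₀ then t else 0)) i (x 0))
            (E4.ofTimeSpace (x 0) (ξ i (x 0))) (M i) (a i) x - Minkowski.bilin)) =
          fun x ↦ Minkowski.bilin + ∑ i, (boostedKerrBilin (Λ i (x 0))
            (E4.ofTimeSpace (x 0) (ξ i (x 0))) (M i) (a i) x - Minkowski.bilin) := by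
        funext x
        refine congrArg _ (Finset.sum_congr rfl fun i _ ↦ ?_)
        beta_reduce
        rw [boostedKerrBilin_mul_rotL]
      have hset_lt : ∀ s : ℝ, {x : U | s < x.1 0 ∧ ∀ i, Kerr.rPlus (M i) (a i) < Kerr.radius (a i)
          (poincareInv ((fun j t ↦ Λ j t * rotL (if j = i₀ then t else 0)) i (x.1 0))
            (E4.ofTimeSpace (x.1 0) (ξ i (x.1 0))) x.1)} =
          {x : U | s < x.1 0 ∧ ∀ i, Kerr.rPlus (M i) (a i) < Kerr.radius (a i)
            (poincareInv (Λ i (x.1 0)) (E4.ofTimeSpace (x.1 0) (ξ i (x.1 0))) x.1)} := by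
        intro s; ext x; simp only [Set.mem_setOf_eq, radius_poincareInv_mul_rotL]
      have hset_eq : ∀ s : ℝ, {x : U | x.1 0 = s ∧ ∀ i, Kerr.rPlus (M i) (a i) < Kerr.radius (a i)
          (poincareInv ((fun j t ↦ Λ j t * rotL (if j = i₀ then t else 0)) i (x.1 0))
            (E4.ofTimeSpace (x.1 0) (ξ i (x.1 0))) x.1)} =
          {x : U | x.1 0 = s ∧ ∀ i, Kerr.rPlus (M i) (a i) < Kerr.radius (a i)
            (poincareInv (Λ i (x.1 0)) (E4.ofTimeSpace (x.1 0) (ξ i (x.1 0))) x.1)} := by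
        intro s; ext x; simp only [Set.mem_setOf_eq, radius_poincareInv_mul_rotL]
      dsimp only at hrest ⊢
      rw [hbil]
      simp only [hset_lt, hset_eq]
      exact hrest
  have htwist := hR X D hD 𝒟 h𝒟 N M a rin (fun j t ↦ Λ j t * rotL (if j = i₀ then t else 0)) ξ γ κ τ₀
    U Φ O hblock' i₀ hiso
  -- contradiction between the two conclusions
  have h3i := (hblock.2.2.1 i₀).2
  simp only [if_true, coe_mul_rotL] at htwist
  have hsum := horig.add htwist
  rw [add_zero] at hsum
  have hev : ∀ᶠ t : ℝ in atTop, (3 / 4 : ℝ) ≤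
      t ^ (3 / 4 : ℝ) / Real.log t * ‖deriv (fun s ↦ ((Λ i₀ s : E4 ≃L[ℝ] E4) : E4 →L[ℝ] E4)) t‖ +
      t ^ (3 / 4 : ℝ) / Real.log t *
        ‖deriv (fun s ↦ ((Λ i₀ s : E4 ≃L[ℝ] E4) : E4 →L[ℝ] E4).comp (rotCLM s)) t‖ := by
    filter_upwards [eventually_weight_ge] with t ht
    have hlow := one_sub_le_norm_deriv_twist (Λ i₀) h3i t
    have hw0 : (0 : ℝ) ≤ t ^ (3 / 4 : ℝ) / Real.log t := by linarith
    nlinarith [hlow, ht, hw0, norm_nonneg (deriv (fun s ↦ ((Λ i₀ s : E4 ≃L[ℝ] E4) : E4 →L[ℝ] E4)) t),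
      mul_le_mul_of_nonneg_left hlow hw0]
  have hlt := hsum.eventually (gt_mem_nhds (by norm_num : (0 : ℝ) < 3 / 4))
  obtain ⟨t, ht1, ht2⟩ := (hev.and hlt).exists
  exact absurd (ht1.trans_lt ht2) (lt_irrefl _)

end Summit.FinalStateConjecture.FinalStateConjecture.Theorems.InertialRecession.Negative

end
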